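import Summits.Parity.GeneralizedHardyLittlewood.Theorems.ChenParityOracleBLAPHostParityFromBrickTypeIReduce
import Summits.Parity.GeneralizedHardyLittlewood.Theorems.ChenParityOracleBLAPHostParityFromBrickTypeISmall
import Summits.Parity.GeneralizedHardyLittlewood.Theorems.ChenParityOracleBLAPHostParityFromBrickTypeILargeCore
import Summits.Parity.GeneralizedHardyLittlewood.Theorems.ChenParityOracleBLAPHostParityFromBrickTypeIBDH
import Summits.Parity.GeneralizedHardyLittlewood.Theorems.ChenParityOracleBLAPHostParityFromBrickTypeINumerics
import HarnessLib

/-!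
# Route `ChenParityOracleBLAP` — crux S1 = `HostParityFromBrick` (stmt-Parity-20045): the unconditional Type-I theorem

Support file for the prime half `K1 → K2 → HP1` of S1.  **Type-I sums of `λ(rs+2)` in arithmetic
progressions to level `x^{1/2−ε}`, with an outer variable `r ≤ x^{1/3−ε_T}` carrying arbitrary
bounded coefficients** (`typeI_shifted_liouville`):
`∑_{d ≤ x^{1/2−ε}, d odd} |∑_{r ≤ R odd} c_r ∑_{s ≤ u/r odd, d ∣ rs+2} λ(rs+2)| ≤ x/(log x)^A`
for all `u ≤ x`, `R ≤ x^{1/3−ε_T}`, `|c_r| ≤ 1`, `x ≥ x₀(A, ε_T)`.  Unconditional: divisor switch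
(`…TypeIReduce`), Bombieri–Vinogradov for `λ` for `d ≤ x^{1/3+ε_T}` (`…TypeISmall`),
Barban–Davenport–Halberstam for `λ` (`…TypeIBDH`) through the piece decomposition
(`…TypeILargeCore`) for larger `d`, numerics (`…TypeINumerics`).

References: E. Bombieri, J. B. Friedlander, H. Iwaniec, Acta Math. 156 (1986), Thm 0
[BombieriFriedlanderIwaniecActa1986]; H. Iwaniec, E. Kowalski, *Analytic Number Theory* (2004),
Thms 17.1, 17.4 [IwaniecKowalski2004].
-/

namespace Summit.Parity.GeneralizedHardyLittlewood.Theorems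

open Finset Real
open ArithmeticFunction (liouville)

/-- **Unconditional Type-I theorem for `λ(rs+2)` to level `x^{1/2−ε}`.**  For `A > 0`,
`0 < ε_T ≤ 1/12`, `0 ≤ ε`: there is `x₀` such that for all `x ≥ x₀`, `u ≤ x`, `R ≤ x^{1/3−ε_T}`
and coefficients `|c_r| ≤ 1`,
`∑_{d ≤ ⌊x^{1/2−ε}⌋, d odd} |∑_{r ≤ R, r odd} c_r ∑_{s ≤ u/r, s odd, d ∣ rs+2} λ(rs+2)| ≤ x/(log x)^A`
[cite: BombieriFriedlanderIwaniecActa1986, Theorem 0; IwaniecKowalski2004, Theorem 17.4]. -/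
theorem typeI_shifted_liouville (A εT ε : ℝ) (hA : 0 < A) (hεT : 0 < εT) (hεT' : εT ≤ 1 / 12)
    (hε : 0 ≤ ε) :
    ∃ x₀ : ℝ, ∀ x : ℕ, x₀ ≤ (x : ℝ) → ∀ u : ℕ, u ≤ x → ∀ R : ℕ,
      (R : ℝ) ≤ (x : ℝ) ^ (1 / 3 - εT) → ∀ c : ℕ → ℝ, (∀ r, |c r| ≤ 1) →
      ∑ d ∈ (Icc 1 ⌊(x : ℝ) ^ (1 / 2 - ε)⌋₊).filter (fun d => Odd d),
        |∑ r ∈ (Icc 1 R).filter (fun r => Odd r),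
          c r * ∑ s ∈ (Icc 1 (u / r)).filter (fun s => Odd s ∧ d ∣ r * s + 2),
            (liouville (r * s + 2) : ℝ)| ≤ (x : ℝ) / Real.log x ^ A := by
  classical
  obtain ⟨lf, hlf⟩ := exists_residue_selector
  obtain ⟨Cs, xs, hCs, hsmall⟩ := typeI_small_d (A + 2) εT (by positivity) hεT (by linarith)
  obtain ⟨Cb, X₀, hCb, hBDH⟩ := bdh_liouville_initial (2 * A + 6) (by positivity)
  obtain ⟨y₀, hy₀⟩ := typeI_thresholds A εT (2 * Cs) Cb xs X₀ hεT
  refine ⟨y₀, fun x hx u hu R hR c hc => ?_⟩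
  obtain ⟨hxs, hx10, hX₀, h34, hL1, hK1, hK2, hK3, hK4⟩ := hy₀ x hx
  have hx' : (1024 : ℝ) ≤ x := by have h := hx10; norm_num at h; exact_mod_cast h
  have hx2 : (2 : ℝ) ≤ x := by linarith only [hx']
  have hx1 : (1 : ℝ) ≤ x := by linarith only [hx']
  have hx0 : (0 : ℝ) < x := by linarith only [hx']
  have hL0 : 0 < Real.log x := by linarith only [hL1]
  have hLA : 0 < Real.log x ^ A := Real.rpow_pos_of_pos hL0 _
  set D : ℕ := ⌊(x : ℝ) ^ (1 / 2 - ε)⌋₊ with hDdef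
  set F := (Icc 1 D).filter (fun d => Odd d) with hFdef
  set S : ℕ → ℕ → ℝ := fun d r => ∑ v ∈ (Icc 1 ((r * (u / r) + 2) / d)).filter
    (fun v : ℕ => (v : ZMod (2 * r)) = ((lf d r : ℕ) : ZMod (2 * r))), (liouville v : ℝ) with hSdef
  set G : ℕ → ℝ := fun d => ∑ r ∈ (Icc 1 R).filter (fun r => Odd r ∧ Nat.Coprime d r), |S d r|
    with hGdef
  -- sizes
  have hDle : (D : ℝ) ≤ (x : ℝ) ^ (1 / 2 : ℝ) :=
    (Nat.floor_le (by positivity)).trans (Real.rpow_le_rpow_of_exponent_le hx1 (by linarith))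
  have hRle : (R : ℝ) ≤ (x : ℝ) ^ (1 / 3 : ℝ) :=
    hR.trans (Real.rpow_le_rpow_of_exponent_le hx1 (by linarith))
  have hRD : (R : ℝ) * D ≤ (x : ℝ) ^ (5 / 6 : ℝ) := by
    calc (R : ℝ) * D ≤ (x : ℝ) ^ (1 / 3 : ℝ) * (x : ℝ) ^ (1 / 2 : ℝ) :=
          mul_le_mul hRle hDle (by positivity) (by positivity)
      _ = (x : ℝ) ^ (5 / 6 : ℝ) := by rw [← Real.rpow_add hx0]; norm_num
  have hcardF : (#F : ℝ) ≤ D := by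
    have : #F ≤ D := (Finset.card_filter_le _ _).trans (by simp)
    exact_mod_cast this
  -- Step A: reduction, per `d`
  have hA' : ∑ d ∈ F, |∑ r ∈ (Icc 1 R).filter (fun r => Odd r),
      c r * ∑ s ∈ (Icc 1 (u / r)).filter (fun s => Odd s ∧ d ∣ r * s + 2),
        (liouville (r * s + 2) : ℝ)| ≤ ∑ d ∈ F, G d + R * D := by
    have h1 : ∀ d ∈ F, |∑ r ∈ (Icc 1 R).filter (fun r => Odd r),
        c r * ∑ s ∈ (Icc 1 (u / r)).filter (fun s => Odd s ∧ d ∣ r * s + 2),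
          (liouville (r * s + 2) : ℝ)| ≤ G d + R := by
      intro d hd
      rw [hFdef, Finset.mem_filter] at hd
      exact typeI_reduce hd.2 lf hlf c hc
    refine (Finset.sum_le_sum h1).trans ?_
    rw [Finset.sum_add_distrib, Finset.sum_const, nsmul_eq_mul]
    nlinarith only [hcardF, (Nat.cast_nonneg R : (0 : ℝ) ≤ R)]
  -- Step B: split `F` at `x^{1/3+εT}`
  have hsplit : ∑ d ∈ F, G d =
      ∑ d ∈ (Icc 1 D).filter (fun d : ℕ => Odd d ∧ (x : ℝ) ^ (1 / 3 + εT) < (d : ℝ)), G d +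
      ∑ d ∈ F.filter (fun d : ℕ => ¬ (x : ℝ) ^ (1 / 3 + εT) < (d : ℝ)), G d := by
    rw [← Finset.sum_filter_add_sum_filter_not F (fun d : ℕ => (x : ℝ) ^ (1 / 3 + εT) < (d : ℝ)),
      hFdef, Finset.filter_filter]
  -- large moduli
  have hlarge := typeI_large_static (ε := ε) hA hCb hεT hεT' hε hBDH hx10 hX₀ h34 hu hR lf hlf
  -- small moduli
  have hsm : ∑ d ∈ F.filter (fun d : ℕ => ¬ (x : ℝ) ^ (1 / 3 + εT) < (d : ℝ)), G d ≤
      Cs * x * (1 + Real.log x) / Real.log x ^ (A + 2) := by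
    have h1 : ∀ d ∈ F.filter (fun d : ℕ => ¬ (x : ℝ) ^ (1 / 3 + εT) < (d : ℝ)),
        G d ≤ Cs * ((x : ℝ) / d) / Real.log x ^ (A + 2) := by
      intro d hd
      rw [Finset.mem_filter, hFdef, Finset.mem_filter, Finset.mem_Icc, not_lt] at hd
      exact hsmall x hxs u hu R hR lf hlf d hd.1.2 hd.1.1.1 hd.2
    refine (Finset.sum_le_sum h1).trans ?_
    have h2 : ∑ d ∈ F.filter (fun d : ℕ => ¬ (x : ℝ) ^ (1 / 3 + εT) < (d : ℝ)),
        Cs * ((x : ℝ) / d) / Real.log x ^ (A + 2) ≤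
        ∑ d ∈ Icc 1 D, Cs * ((x : ℝ) / d) / Real.log x ^ (A + 2) :=
      Finset.sum_le_sum_of_subset_of_nonneg
        ((Finset.filter_subset _ _).trans (Finset.filter_subset _ _)) fun d _ _ => by positivity
    refine h2.trans ?_
    have h3 : ∑ d ∈ Icc 1 D, Cs * ((x : ℝ) / d) / Real.log x ^ (A + 2) =
        Cs * x / Real.log x ^ (A + 2) * ∑ d ∈ Icc 1 D, (1 : ℝ) / d := by
      rw [Finset.mul_sum]; refine Finset.sum_congr rfl fun d _ => ?_; ring
    rw [h3]
    have h4 := sum_inv_Icc_le_log D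
    have h5 : Real.log (max (D : ℝ) 1) ≤ Real.log x := by
      refine Real.log_le_log (by positivity) (max_le (hDle.trans ?_) hx1)
      calc (x : ℝ) ^ (1 / 2 : ℝ) ≤ (x : ℝ) ^ (1 : ℝ) := Real.rpow_le_rpow_of_exponent_le hx1 (by norm_num)
        _ = x := Real.rpow_one _
    have h6 : ∑ d ∈ Icc 1 D, (1 : ℝ) / d ≤ 1 + Real.log x := by linarith
    calc Cs * x / Real.log x ^ (A + 2) * ∑ d ∈ Icc 1 D, (1 : ℝ) / d
        ≤ Cs * x / Real.log x ^ (A + 2) * (1 + Real.log x) :=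
          mul_le_mul_of_nonneg_left h6 (by positivity)
      _ = Cs * x * (1 + Real.log x) / Real.log x ^ (A + 2) := by ring
  -- Step C: numerics
  have hT1 := typeI_T1_le (A := A) (C := Cb) hεT hx2 hL1 hK1
  have hT2 := typeI_T2_le (A := A) hεT (by linarith) hx2 hL1 hK2
  have hT3 := typeI_T3_le (A := A) hx1 hK3 hLA
  have hS' := typeI_small_le (A := A) (Cs := 2 * Cs) hx0.le hL1 (by linarith)
  have hsm' : Cs * x * (1 + Real.log x) / Real.log x ^ (A + 2) ≤ (x : ℝ) / (8 * Real.log x ^ A) := by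
    have e : 2 * Cs * x * (1 + Real.log x) / Real.log x ^ (A + 2) =
        2 * (Cs * x * (1 + Real.log x) / Real.log x ^ (A + 2)) := by ring
    rw [e] at hS'
    have e2 : (x : ℝ) / (8 * Real.log x ^ A) = ((x : ℝ) / (4 * Real.log x ^ A)) / 2 := by
      field_simp; ring
    rw [e2]; linarith
  have hRD' : (R : ℝ) * D ≤ (x : ℝ) / (8 * Real.log x ^ A) := by
    have e2 : (x : ℝ) / (8 * Real.log x ^ A) = ((x : ℝ) / (4 * Real.log x ^ A)) / 2 := by
      field_simp; ring
    rw [e2]; linarith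
  have htot : (x : ℝ) / (4 * Real.log x ^ A) + (x : ℝ) / (4 * Real.log x ^ A) +
      (x : ℝ) / (4 * Real.log x ^ A) + (x : ℝ) / (8 * Real.log x ^ A) +
      (x : ℝ) / (8 * Real.log x ^ A) = (x : ℝ) / Real.log x ^ A := by
    field_simp; ring
  rw [← htot]
  refine hA'.trans ?_
  rw [hsplit]
  linarith [hlarge, hsm, hT1, hT2, hT3, hsm', hRD']

end Summit.Parity.GeneralizedHardyLittlewood.Theorems
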